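import Mathlib
import HarnessLib

/-!
# `KernelModuloPeriodConjecture`, line `Sketch`, Stage 2: block-lower-triangular-mod-2 determinant

Crux `FurushoPentagon.KernelModuloPeriodConjecture` (stmt-KontsevichZagierPeriods-15058), line
`Sketch`, Stage 2 (block certificates for the kernel-checkable `𝔽₂` rank engine `LinEDS` of the
linearised extended double shuffle system): the integer relation matrix of one weight is cut into
blocks, positions being pairs `⟨β, x⟩` of a block `β : Fin B` and an index `x : Fin (nb β)`, i.e.
elements of the sigma type `Σ β : Fin B, Fin (nb β)`. If an integer matrix `A` on these positions
is block LOWER triangular MODULO `2` (every entry of a row of block `β` in a column of a later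
block is even) and every diagonal block `(A ⟨β, x⟩ ⟨β, y⟩)_{x, y}` has odd determinant, then `A`
has odd determinant (`stub_blockDet_odd`).

Proof: reduce modulo `2` (`Int.cast_det`, `ZMod.intCast_eq_one_iff_odd`,
`ZMod.intCast_eq_zero_iff_even`); the transpose of the reduction is `Matrix.BlockTriangular` for
the block map `Sigma.fst`, so its determinant is the product over `k : Fin B` of the determinants
of its diagonal square blocks (`Matrix.BlockTriangular.det_fintype`); the square block at `k`,
indexed by the subtype `{i // i.1 = k}`, is the reindexing along `Equiv.sigmaSubtype k` of the
transpose of the reduction of the `k`-th diagonal block of `A` (`Matrix.det_submatrix_equiv_self`),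
so its determinant is `1`. Empty blocks (`nb β = 0`) are harmless: a `0 × 0` determinant is `1`
on both sides. Elementary linear algebra over `𝔽₂`. [folklore]
-/

namespace Summit.KontsevichZagierPeriods.FurushoPentagon.KernelModuloPeriodConjecture

/-- **Stage 2 — a block-lower-triangular-mod-2 integer matrix with odd diagonal block
determinants has odd determinant.** Positions are pairs (block `β : Fin B`, index in
`Fin (nb β)`); if every entry of `A` strictly above the block diagonal is even and every diagonal
block of `A` has odd determinant, then `A.det` is odd: modulo `2` the matrix is block triangular,
so its determinant is the product of the diagonal block determinants, all equal to `1`.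
[folklore] -/
theorem stub_blockDet_odd :
    ∀ (B : ℕ) (nb : Fin B → ℕ)
      (A : Matrix ((β : Fin B) × Fin (nb β)) ((β : Fin B) × Fin (nb β)) ℤ),
      (∀ i j, i.1 < j.1 → Even (A i j)) →
      (∀ β, Odd (Matrix.of fun (x y : Fin (nb β)) => A ⟨β, x⟩ ⟨β, y⟩).det) →
      Odd A.det := by
  intro B nb A hE hO
  rw [← ZMod.intCast_eq_one_iff_odd, Int.cast_det, ← Matrix.det_transpose]
  have hT : (Matrix.transpose (A.map fun x : ℤ => (x : ZMod 2))).BlockTriangular Sigma.fst :=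
    fun i j hij => ZMod.intCast_eq_zero_iff_even.2 (hE j i hij)
  rw [hT.det_fintype, Finset.prod_eq_one]
  intro k _
  rw [← Matrix.det_submatrix_equiv_self (Equiv.sigmaSubtype k).symm,
    ← ZMod.intCast_eq_one_iff_odd.2 (hO k), Int.cast_det, ← Matrix.det_transpose]
  rfl

end Summit.KontsevichZagierPeriods.FurushoPentagon.KernelModuloPeriodConjecture
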